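import Summits.Ventures.PercRepro.C041TriDomGlueInduction

/-!
# ROW C-041 — THE TWO-EXIT MARKLESS PIECE, I: THE CONNECTIVITIES
(p6, gen 46; P6-TWOEXIT-LEAN.md §53 ADDENDUM 17)

A markless vertex set `K` attached to the rest of the host by EXACTLY TWO FREE EDGES `f₁ = K–u`, `f₂ = K–v`
(`TwoExit`: every other present edge touching `K` is internal to `K`; `u, v ∉ K`, coincidences `u = v` allowed).  Two
derived statuses: `stDel st f₁ f₂` (both exit edges deleted — `K` becomes an isolated markless piece) and
`stCon st f₁` (`f₁` contracted — `f₂` becomes a chord from `u`'s class to `v`).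

**THE FIBRE IDENTITY.**  For a colouring `ω` and vertices `a, b` off `K`:
* `ω f₁ = ω f₂` ⟹ the red and blue connectivities of `st` and `stCon` agree (`RdS_stCon_iff`, `MgS_stCon_iff`);
* `ω f₁ ≠ ω f₂` ⟹ those of `st` and `stDel` agree (`RdS_stDel_iff`, `MgS_stDel_iff`).

Everything rests on ONE lemma (`rtg_addEdge_iff`): adding a single edge between `K` and its complement to a relation
with no edge between `K` and its complement changes no connectivity among the vertices off `K` — a walk can only enter
`K` through the new edge and must leave through it again (induction on the walk with the invariant «off `K`: reached;
in `K`: the outer end of the new edge is reached»).  Under `st` with both exits of the same colour, the other colour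
has no edge between `K` and its complement; under `stDel` neither colour has.  The connectivities of `stCon` ignore the
colour of `f₁`, those of `stDel` the colours of `f₁, f₂` (`RdS_stCon_congr`, `RdS_stDel_congr`, …).
Continued in `C041TriDomTwoExitCount` (the fibre count) and `C041TriDomTwoExitInduction` (the reduction).
-/

namespace PercRepro

namespace ZoneZ

namespace MultiExit

open ZoneData Finset

variable {V₁ E₁ U₁ U₂ : Type} (Z₁ : ZoneData V₁ E₁ U₁ U₂)

/-! ## The abstract lemma: one edge into a piece changes nothing outside -/

/-- Adding one edge `u–w` between a set `K ∋ w` and its complement `∌ u` to a relation with no edge between `K` and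
its complement changes no connectivity among the vertices off `K`. -/
theorem rtg_addEdge_iff {R : V₁ → V₁ → Prop} {K : Set V₁} {w u : V₁} (hw : w ∈ K) (hu : u ∉ K)
    (hR : ∀ c d, R c d → (c ∈ K ↔ d ∈ K)) {a b : V₁} (ha : a ∉ K) (hb : b ∉ K) :
    Relation.ReflTransGen (fun c d => R c d ∨ (c = u ∧ d = w) ∨ (c = w ∧ d = u)) a b ↔
      Relation.ReflTransGen R a b := by
  constructor
  · intro h
    have key : ∀ c, Relation.ReflTransGen (fun c d => R c d ∨ (c = u ∧ d = w) ∨ (c = w ∧ d = u)) a c →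
        (c ∉ K ∧ Relation.ReflTransGen R a c) ∨ (c ∈ K ∧ Relation.ReflTransGen R a u) := by
      intro c hc
      induction hc with
      | refl => exact Or.inl ⟨ha, Relation.ReflTransGen.refl⟩
      | @tail c d _ hcd ih =>
        rcases hcd with hcd | ⟨hcu, hdw⟩ | ⟨hcw, hdu⟩
        · rcases ih with ⟨hcK, hac⟩ | ⟨hcK, hau⟩
          · exact Or.inl ⟨fun hdK => hcK ((hR c d hcd).mpr hdK), hac.tail hcd⟩
          · exact Or.inr ⟨(hR c d hcd).mp hcK, hau⟩
        · rcases ih with ⟨_, hau⟩ | ⟨huK, _⟩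
          · rw [hdw]
            rw [hcu] at hau
            exact Or.inr ⟨hw, hau⟩
          · rw [hcu] at huK
            exact absurd huK hu
        · rcases ih with ⟨hwK, _⟩ | ⟨_, hau⟩
          · rw [hcw] at hwK
            exact absurd hw hwK
          · rw [hdu]
            exact Or.inl ⟨hu, hau⟩
    rcases key b h with ⟨_, hab⟩ | ⟨hbK, _⟩
    · exact hab
    · exact absurd hbK hb
  · intro h
    clear hb
    induction h with
    | refl => exact Relation.ReflTransGen.refl
    | tail _ hcd ih => exact ih.tail (Or.inl hcd)

/-- The pairs joined by an edge joining `w` and `u`. -/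
theorem joins_iff_of_joins {f : E₁} {w u : V₁} (hj : Z₁.Joins f w u) (c d : V₁) :
    Z₁.Joins f c d ↔ (c = u ∧ d = w) ∨ (c = w ∧ d = u) := by
  unfold ZoneData.Joins at hj ⊢
  rcases hj with ⟨h1, h2⟩ | ⟨h1, h2⟩
  · rw [h1, h2]
    constructor
    · rintro (⟨h3, h4⟩ | ⟨h3, h4⟩)
      · exact Or.inr ⟨h3.symm, h4.symm⟩
      · exact Or.inl ⟨h4.symm, h3.symm⟩
    · rintro (⟨h3, h4⟩ | ⟨h3, h4⟩)
      · exact Or.inr ⟨h4.symm, h3.symm⟩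
      · exact Or.inl ⟨h3.symm, h4.symm⟩
  · rw [h1, h2]
    constructor
    · rintro (⟨h3, h4⟩ | ⟨h3, h4⟩)
      · exact Or.inl ⟨h3.symm, h4.symm⟩
      · exact Or.inr ⟨h4.symm, h3.symm⟩
    · rintro (⟨h3, h4⟩ | ⟨h3, h4⟩)
      · exact Or.inl ⟨h3.symm, h4.symm⟩
      · exact Or.inr ⟨h4.symm, h3.symm⟩

/-- Equivalent colour predicates give the same adjacency. -/
theorem AdjCol_iff_of_iff {col col' : E₁ → Prop} (h : ∀ e, col e ↔ col' e) (c d : V₁) :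
    AdjCol Z₁ col c d ↔ AdjCol Z₁ col' c d :=
  exists_congr fun e => and_congr_right fun _ => h e

/-- The adjacency through a colour predicate, with one extra edge `f` joining `w` and `u`. -/
theorem AdjCol_or_edge_iff {col : E₁ → Prop} {f : E₁} {w u : V₁} (hj : Z₁.Joins f w u) (c d : V₁) :
    AdjCol Z₁ (fun e => col e ∨ e = f) c d ↔ AdjCol Z₁ col c d ∨ (c = u ∧ d = w) ∨ (c = w ∧ d = u) := by
  constructor
  · rintro ⟨e, he, hc | rfl⟩
    · exact Or.inl ⟨e, he, hc⟩
    · exact Or.inr ((joins_iff_of_joins Z₁ hj c d).mp he)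
  · rintro (⟨e, he, hc⟩ | h)
    · exact ⟨e, he, Or.inl hc⟩
    · exact ⟨f, (joins_iff_of_joins Z₁ hj c d).mpr h, Or.inr rfl⟩

/-! ## The two-exit piece and its two derived statuses -/

/-- `K` is a TWO-EXIT MARKLESS PIECE of the status `st` with the exits `f₁ = K–u` and `f₂ = K–v`: the exits are free,
their outer ends `u, v` lie off `K`, and every other present edge touching `K` is internal to `K`.  (The marks are
required to lie off `K` by the theorems that use it.) -/
structure TwoExit (st : E₁ → EStat) (K : Set V₁) (u v : V₁) (f₁ f₂ : E₁) : Prop where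
  /-- the outer end of `f₁` is off `K` -/
  hu : u ∉ K
  /-- the outer end of `f₂` is off `K` -/
  hv : v ∉ K
  /-- the two exits are distinct edges -/
  hne : f₁ ≠ f₂
  /-- `f₁` is free -/
  hs₁ : st f₁ = EStat.free
  /-- `f₂` is free -/
  hs₂ : st f₂ = EStat.free
  /-- `f₁` joins a vertex of `K` to `u` -/
  hj₁ : ∃ w ∈ K, Z₁.Joins f₁ w u
  /-- `f₂` joins a vertex of `K` to `v` -/
  hj₂ : ∃ w ∈ K, Z₁.Joins f₂ w v
  /-- every present edge touching `K` is an exit or internal -/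
  hint : ∀ e, presE st e → Z₁.Touches K e → e = f₁ ∨ e = f₂ ∨ (Z₁.fst e ∈ K ∧ Z₁.snd e ∈ K)

variable {st : E₁ → EStat} {K : Set V₁} {u v : V₁} {f₁ f₂ : E₁}

/-- A free edge is red iff its colour is red. -/
theorem redE_free_iff {f : E₁} (hf : st f = EStat.free) (ω : E₁ → Bool) : redE st ω f ↔ ω f = true := by
  unfold redE
  rw [hf]
  simp

/-- A free edge is blue iff its colour is blue. -/
theorem blueE_free_iff {f : E₁} (hf : st f = EStat.free) (ω : E₁ → Bool) : blueE st ω f ↔ ω f = false := by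
  unfold blueE
  rw [hf]
  simp

/-- Under a colour predicate satisfied by no exit edge, no edge of that colour crosses between `K` and its
complement. -/
theorem adj_no_cross (hT : TwoExit Z₁ st K u v f₁ f₂) {col : E₁ → Prop} (hcol : ∀ e, col e → presE st e)
    (h₁ : ¬ col f₁) (h₂ : ¬ col f₂) : ∀ c d, AdjCol Z₁ col c d → (c ∈ K ↔ d ∈ K) := by
  rintro c d ⟨e, hj, hc⟩
  by_cases ht : Z₁.Touches K e
  · rcases hT.hint e (hcol e hc) ht with he | he | ⟨h1, h2⟩
    · exact absurd (he ▸ hc) h₁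
    · exact absurd (he ▸ hc) h₂
    · unfold ZoneData.Joins at hj
      rcases hj with ⟨hc', hd'⟩ | ⟨hd', hc'⟩
      · rw [← hc', ← hd']
        exact ⟨fun _ => h2, fun _ => h1⟩
      · rw [← hc', ← hd']
        exact ⟨fun _ => h1, fun _ => h2⟩
  · unfold ZoneData.Touches at ht
    rw [not_or] at ht
    unfold ZoneData.Joins at hj
    rcases hj with ⟨hc', hd'⟩ | ⟨hd', hc'⟩
    · rw [← hc', ← hd']
      exact ⟨fun h => absurd h ht.1, fun h => absurd h ht.2⟩
    · rw [← hc', ← hd']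
      exact ⟨fun h => absurd h ht.2, fun h => absurd h ht.1⟩

/-- A free red edge is not blue. -/
theorem not_blueE_of_red {f : E₁} (hf : st f = EStat.free) {ω : E₁ → Bool} (h : ω f = true) : ¬ blueE st ω f := by
  rw [blueE_free_iff hf, h]
  decide

/-- A free blue edge is not red. -/
theorem not_redE_of_blue {f : E₁} (hf : st f = EStat.free) {ω : E₁ → Bool} (h : ω f = false) : ¬ redE st ω f := by
  rw [redE_free_iff hf, h]
  decide

/-- THE REACH LEMMA: if the `col'`-adjacency is the `col`-adjacency plus one exit edge `f = w–x` (`w ∈ K`, `x ∉ K`)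
and no exit edge has the colour `col`, the two connectivities agree between vertices off `K`. -/
theorem reach_iff_of_col_or_exit (hT : TwoExit Z₁ st K u v f₁ f₂) {col col' : E₁ → Prop} {f : E₁} {w x : V₁}
    (hw : w ∈ K) (hx : x ∉ K) (hj : Z₁.Joins f w x) (hcol : ∀ e, col e → presE st e) (h₁ : ¬ col f₁)
    (h₂ : ¬ col f₂) (hcol' : ∀ e, col' e ↔ col e ∨ e = f) {a b : V₁} (ha : a ∉ K) (hb : b ∉ K) :
    b ∈ ZoneData.reach (AdjCol Z₁ col') {a} ↔ b ∈ ZoneData.reach (AdjCol Z₁ col) {a} := by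
  have hadj : AdjCol Z₁ col' = fun c d => AdjCol Z₁ col c d ∨ (c = x ∧ d = w) ∨ (c = w ∧ d = x) := by
    funext c d
    exact propext ((AdjCol_iff_of_iff Z₁ hcol' c d).trans (AdjCol_or_edge_iff Z₁ hj c d))
  rw [hadj, mem_reach_singleton, mem_reach_singleton]
  exact rtg_addEdge_iff hw hx (adj_no_cross Z₁ hT hcol h₁ h₂) ha hb

/-! ## The connectivities ignore the colours of non-free edges -/

/-- Two colourings agreeing on the free edges have the same red connectivity. -/
theorem RdS_congr_free (st : E₁ → EStat) {ω ω' : E₁ → Bool} (h : ∀ e, st e = EStat.free → ω e = ω' e) :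
    RdS Z₁ st ω = RdS Z₁ st ω' := by
  unfold RdS
  rw [RAdjS_congr Z₁ fun e => ?_]
  unfold redE
  by_cases hf : st e = EStat.free
  · rw [h e hf]
  · simp [hf]

/-- Two colourings agreeing on the free edges have the same blue connectivity. -/
theorem MgS_congr_free (st : E₁ → EStat) {ω ω' : E₁ → Bool} (h : ∀ e, st e = EStat.free → ω e = ω' e) :
    MgS Z₁ st ω = MgS Z₁ st ω' := by
  unfold MgS
  rw [BAdjS_congr Z₁ fun e => ?_]
  unfold blueE
  by_cases hf : st e = EStat.free
  · rw [h e hf]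
  · simp [hf]

variable [DecidableEq E₁]


/-- The status with the two exit edges `f₁, f₂` deleted. -/
def stDel (st : E₁ → EStat) (f₁ f₂ : E₁) : E₁ → EStat := fun e => if e = f₁ ∨ e = f₂ then EStat.absent else st e

/-- The status with the exit edge `f₁` contracted. -/
def stCon (st : E₁ → EStat) (f₁ : E₁) : E₁ → EStat := fun e => if e = f₁ then EStat.double else st e

/-- Red under `stCon`: red under `st`, or the contracted edge. -/
theorem redE_stCon (ω : E₁ → Bool) (e : E₁) : redE (stCon st f₁) ω e ↔ redE st ω e ∨ e = f₁ := by
  unfold stCon redE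
  by_cases h : e = f₁ <;> simp [h]

/-- Blue under `stCon`: blue under `st`, or the contracted edge. -/
theorem blueE_stCon (ω : E₁ → Bool) (e : E₁) : blueE (stCon st f₁) ω e ↔ blueE st ω e ∨ e = f₁ := by
  unfold stCon blueE
  by_cases h : e = f₁ <;> simp [h]

/-- Red under `stDel`: red under `st` and not an exit. -/
theorem redE_stDel (ω : E₁ → Bool) (e : E₁) :
    redE (stDel st f₁ f₂) ω e ↔ redE st ω e ∧ ¬ (e = f₁ ∨ e = f₂) := by
  unfold stDel redE
  by_cases h : e = f₁ ∨ e = f₂ <;> simp [h]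

/-- Blue under `stDel`: blue under `st` and not an exit. -/
theorem blueE_stDel (ω : E₁ → Bool) (e : E₁) :
    blueE (stDel st f₁ f₂) ω e ↔ blueE st ω e ∧ ¬ (e = f₁ ∨ e = f₂) := by
  unfold stDel blueE
  by_cases h : e = f₁ ∨ e = f₂ <;> simp [h]

/-! ## Both exits of the same colour: `st` and `stCon` agree off `K` -/

/-- Both exits red: the red adjacencies of `st` and `stCon` coincide. -/
theorem RAdjS_stCon_eq_of_red (hs₁ : st f₁ = EStat.free) (ω : E₁ → Bool) (h₁ : ω f₁ = true) :
    RAdjS Z₁ (stCon st f₁) ω = RAdjS Z₁ st ω := by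
  apply RAdjS_congr
  intro e
  rw [redE_stCon]
  constructor
  · rintro (h | h)
    · exact h
    · rw [h, redE_free_iff hs₁]
      exact h₁
  · exact Or.inl

/-- Both exits blue: the blue adjacencies of `st` and `stCon` coincide. -/
theorem BAdjS_stCon_eq_of_blue (hs₁ : st f₁ = EStat.free) (ω : E₁ → Bool) (h₁ : ω f₁ = false) :
    BAdjS Z₁ (stCon st f₁) ω = BAdjS Z₁ st ω := by
  apply BAdjS_congr
  intro e
  rw [blueE_stCon]
  constructor
  · rintro (h | h)
    · exact h
    · rw [h, blueE_free_iff hs₁]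
      exact h₁
  · exact Or.inl

/-- Both exits red: off `K`, the blue connectivity of `stCon` is that of `st`. -/
theorem MgS_stCon_iff_of_red (hT : TwoExit Z₁ st K u v f₁ f₂) (ω : E₁ → Bool) (h₁ : ω f₁ = true)
    (h₂ : ω f₂ = true) {a b : V₁} (ha : a ∉ K) (hb : b ∉ K) :
    MgS Z₁ (stCon st f₁) ω a b ↔ MgS Z₁ st ω a b := by
  obtain ⟨w, hw, hj⟩ := hT.hj₁
  unfold MgS
  rw [BAdjS_eq_AdjCol, BAdjS_eq_AdjCol]
  exact reach_iff_of_col_or_exit Z₁ hT hw hT.hu hj (fun e he => blueE_pres he) (not_blueE_of_red hT.hs₁ h₁)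
    (not_blueE_of_red hT.hs₂ h₂) (blueE_stCon ω) ha hb

/-- Both exits blue: off `K`, the red connectivity of `stCon` is that of `st`. -/
theorem RdS_stCon_iff_of_blue (hT : TwoExit Z₁ st K u v f₁ f₂) (ω : E₁ → Bool) (h₁ : ω f₁ = false)
    (h₂ : ω f₂ = false) {a b : V₁} (ha : a ∉ K) (hb : b ∉ K) :
    RdS Z₁ (stCon st f₁) ω a b ↔ RdS Z₁ st ω a b := by
  obtain ⟨w, hw, hj⟩ := hT.hj₁
  unfold RdS
  rw [RAdjS_eq_AdjCol, RAdjS_eq_AdjCol]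
  exact reach_iff_of_col_or_exit Z₁ hT hw hT.hu hj (fun e he => redE_pres he) (not_redE_of_blue hT.hs₁ h₁)
    (not_redE_of_blue hT.hs₂ h₂) (redE_stCon ω) ha hb

/-- **Both exits of the same colour**: off `K`, the red connectivity of `stCon` is that of `st`. -/
theorem RdS_stCon_iff (hT : TwoExit Z₁ st K u v f₁ f₂) (ω : E₁ → Bool) (h : ω f₁ = ω f₂) {a b : V₁}
    (ha : a ∉ K) (hb : b ∉ K) : RdS Z₁ (stCon st f₁) ω a b ↔ RdS Z₁ st ω a b := by
  rcases Bool.eq_false_or_eq_true (ω f₁) with h₁ | h₁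
  · unfold RdS
    rw [RAdjS_stCon_eq_of_red Z₁ hT.hs₁ ω h₁]
  · exact RdS_stCon_iff_of_blue Z₁ hT ω h₁ (h ▸ h₁) ha hb

/-- **Both exits of the same colour**: off `K`, the blue connectivity of `stCon` is that of `st`. -/
theorem MgS_stCon_iff (hT : TwoExit Z₁ st K u v f₁ f₂) (ω : E₁ → Bool) (h : ω f₁ = ω f₂) {a b : V₁}
    (ha : a ∉ K) (hb : b ∉ K) : MgS Z₁ (stCon st f₁) ω a b ↔ MgS Z₁ st ω a b := by
  rcases Bool.eq_false_or_eq_true (ω f₁) with h₁ | h₁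
  · exact MgS_stCon_iff_of_red Z₁ hT ω h₁ (h ▸ h₁) ha hb
  · unfold MgS
    rw [BAdjS_stCon_eq_of_blue Z₁ hT.hs₁ ω h₁]

end MultiExit

end ZoneZ

end PercRepro
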